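import Summits.NavierStokesRegularity.NavierStokesRegularity.Theorems.ExtremiserTransienceAveragedRung
import Summits.NavierStokesRegularity.NavierStokesRegularity.Theorems.TypeICertificateLadderTargetStrainCubeLambSplitDepletion
import HarnessLib

/-!
# Route `ExtremiserTransience`, crux K1 `NearExtremalTransience` (stmt-NavierStokesRegularity-21883):
# WHAT K1 BUYS after the Lamb / strain-cube split — reach `(18 − 4√15)/θ`

`--supports stmt-NavierStokesRegularity-21883` (helper). Author: STA lineage `ns-sta-19551-p1` (g11).

The landed `rung_of_nearExtremalTransience` (p574441) instantiates the `κ`-premise of K1 with the chain constant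
`(2+√3)/9` (`StrainCube.sharp_constant_is_universal`) and gets the rung family `X_C`, `C < (18 − 9√3)/θ`. The
split constant `(9 + 2√15)/42` is universal too (`StrainCube.lambSplit_constant_is_universal`, p-LambSplitDepletion),
so the same argument gives `X_C` for every `C` with `θ·((9+2√15)/42)·C < 1`, i.e. `C < (18 − 4√15)/θ`
(`rung_of_nearExtremalTransience_lambSplit`); and unconditionally (`θ = 1`, no K1) the reach is `18 − 4√15 ≈ 2.508`
(`StrainCube.rung_of_le_lambSplit`). Since K1 quantifies over EVERY universal `κ`, its content is unchanged (it is
equivalent to its instance at the sharp constant `κ⋆ ∈ (13/200, (9+2√15)/42]`); what moves is the certified pay-off.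
WHAT THIS IS NOT: K1 stays open; nothing on Type II. [folklore]
-/

noncomputable section

open Set Filter Topology MeasureTheory
open scoped RealInnerProductSpace ENNReal NNReal ContDiff
open Literature.Analysis.FluidPDE

namespace Summit.NavierStokesRegularity.NavierStokesRegularity.Theorems

-- the problem directory repeats the summit name (`NavierStokesRegularity/NavierStokesRegularity`)
set_option linter.dupNamespace false

namespace DepletionLadder

open Summit.NavierStokesRegularity.NavierStokesRegularity.Theorems.RungReynoldsOne

/-- **What `NearExtremalTransience` buys on the split chain**: `∃ θ ∈ [0,1)` (the crux's) such that for every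
`C > 0` with `θ·((9+2√15)/42)·C < 1` every classical Leray–Hopf rapidly-decaying-datum solution on `[0,T)` with
eventual rate `√(T−t)‖u(t,x)‖ ≤ C√ν` extends smoothly past `T` — reach `(18 − 4√15)/θ` (`= ∞` if `θ = 0`),
versus `(18 − 9√3)/θ` from the chain constant (p574441). Proof: the `κ`-premise of the crux is met by
`κ = (9+2√15)/42` (`StrainCube.lambSplit_constant_is_universal`); `rung_of_logMeanDepletion` at level
`r = θ(9+2√15)/42`. No `DepletionCascade` is used. [folklore] -/
theorem rung_of_nearExtremalTransience_lambSplit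
    (hNET : Summit.NavierStokesRegularity.NavierStokesRegularity.Theses.ExtremiserTransience.NearExtremalTransience) :
    ∃ θ : ℝ, 0 ≤ θ ∧ θ < 1 ∧ ∀ (C ν T : ℝ), 0 < C → θ * ((9 + 2 * Real.sqrt 15) / 42) * C < 1 → 0 < ν →
      0 < T → ∀ (u : ℝ → EuclideanSpace ℝ (Fin 3) → EuclideanSpace ℝ (Fin 3))
        (p : ℝ → EuclideanSpace ℝ (Fin 3) → ℝ),
        IsClassicalNSSolutionOn (Ico 0 T) ν 0 u p → IsLerayHopfOn T ν 0 (u 0) u →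
        HasRapidSpatialDecay (u 0) →
        (∀ᶠ t in 𝓝[<] T, ∀ x, Real.sqrt (T - t) * ‖u t x‖ ≤ C * Real.sqrt ν) →
        HasSmoothExtensionPast ν 0 u T := by
  obtain ⟨θ, hθ0, hθ1, hθ⟩ := hNET
  refine ⟨θ, hθ0, hθ1, fun C ν T hC hθC hν hT u p hsol hLH hdec hrate => ?_⟩
  by_contra hext
  have hκ := hθ ((9 + 2 * Real.sqrt 15) / 42) StrainCube.lambSplit_constant_is_universal C ν T hC hν hT u p
    hsol hLH hdec hrate hext
  obtain ⟨t₁, ht₁, k, B, hkm, hk01, hflow, hmean⟩ := hκ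
  have hr : 0 ≤ θ * ((9 + 2 * Real.sqrt 15) / 42) := by positivity
  exact hext (rung_of_logMeanDepletion hν hT hr hC hθC ht₁ hsol hLH hdec hkm hk01 hflow hmean hrate)

/-- The certified pay-off of K1 moved: for `0 < θ`, `(18 − 9√3)/θ < (18 − 4√15)/θ` (`2.4115/θ < 2.5080/θ`).
[folklore] -/
theorem nearExtremalTransience_reach_lt {θ : ℝ} (hθ : 0 < θ) :
    (18 - 9 * Real.sqrt 3) / θ < (18 - 4 * Real.sqrt 15) / θ := by
  refine div_lt_div_of_pos_right ?_ hθ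
  have h15 : Real.sqrt 15 < 3.88 := by
    rw [Real.sqrt_lt' (by norm_num)]; norm_num
  have h3 : (1.73 : ℝ) < Real.sqrt 3 := by
    rw [Real.lt_sqrt (by norm_num)]; norm_num
  linarith

end DepletionLadder

end Summit.NavierStokesRegularity.NavierStokesRegularity.Theorems

end
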